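import Summits.QuantumFields.BalabanUV.Beta.D1BFx.ReducedTableF
import Summits.QuantumFields.BalabanUV.Beta.D1BFx.MomentTransferParity

/-!
# `BalabanUV.Beta.D1BFx.ReducedTableBridge` — road «BF-x» for binder row D1, sub-leaf T8-bridge: THE TYPER'S GENERIC DRESSED TABLE
# `ReducedTableF.tableRedF` AND LEAF A4'S `DressedTadpoleTable.tableRed` COINCIDE AT THE FIBRE `Fin 4` (under the road's standing
# bi-localisation hypothesis), and every socket / END statement of either file READ ON THE OTHER OBJECT BY NAME

HONEST DEPENDENCY (page 1, mandatory): continuum YM on T⁴ ⇐ BetaPertH ∧ nine spine estimates (0/9 proved); BetaPertH ⇐ (D1) ∧ (D4) ∧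
CAP+tail; G-an2-4 gates asym, D1 and NE2/3/4.  HONEST FRAMING (cell contract, verbatim): «discharging `BetaPertH` makes Bałaban's UV
stability UNCONDITIONAL — a real constructive-QFT result; it is NOT the continuum limit and NOT the Clay problem.»  THIS FILE DISCHARGES
NOTHING: it is [folklore] bookkeeping (one exchange of a finite sum with an absolutely convergent lattice series); 0 binders of the hR
root are touched; no definition, no `def … : Prop`, no citation, no hypothesis is a printed statement.
ABSOLUTE RULE (cell charter, verbatim): «No internally-minted statement may enter as a cited fact. Every hypothesis is either
kernel-proved in this package or a verbatim quotation of a PUBLISHED theorem with page reference. The manuscript(s) under audit are NOT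
citable for their own disputed steps — they are the thing under adjudication; programme-internal (2001/route/tribunal) claims are never
citable.»

WHY.  Two normalisations of the `ℋ ⊗ ℋ`-dressing of a second-order FINE table family `Wf κ′ u λ′ u′` into the coarse `W`-slot of the reduced
one-shot kernel are in the tree: the typer's generic-fibre `ReducedTableF.tableRedF n Wf μ y ν y′ = Σ_{κ′} Σ_{λ′} Σ′_u ℋ · (Σ′_{u′} ℋ · Wf)`
(p210460; carries the `VertexFamily₂` / block-covariance sockets of `ReducedKernelF.TOfLeg`) and leaf A4's `DressedTadpoleTable.tableRed n Wf
μ y ν y′ = Σ_{κ′} Σ′_u ℋ · (Σ_{λ′} Σ′_{u′} ℋ · Wf)` at `F = Fin 4` (p210026; the ITERATED chain-rule vertex, carries the tadpole exchange and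
the END `ReducedKernelSandwich.secondMoment_TOfRed_eq` of A4).  They differ by the position of the finite sum `Σ_{λ′}` relative to the outer
series `Σ′_u`, so they are NOT definitionally equal (an unconditional equality would compare junk values of non-summable `tsum`s); they ARE
equal under the road's standing hypothesis `∀ κ′ u λ′ u′, BiLoc (Wf κ′ u λ′ u′) u u′ C δ`, `0 < δ` — the inner superpositions are then
uniformly bounded (`DressedTadpoleTable.biLoc_wsum_snd`) and the `ℋ`-weights are absolutely summable (`DressedBubbleTable.exists_expWeight_wH`),
so `Summable.tsum_finsetSum` exchanges `Σ_{λ′}` and `Σ′_u` (typer «go», journal 2026-08-20T07:20:04Z).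

CONTENT.
* §1 [folklore, generic `D`, `F`] `summable_wmul_of_bound`, `finset_sum_wsum` (a finite sum of superpositions with a common weight is the
  superposition of the finite sum, given termwise summability).
* §2 [folklore] `tableRed_apply`; **`tableRedF_eq_tableRed`** (the bridge); `TOfLeg_tableRedF_eq_TOfRed_tableRed`.
* §3 [folklore] A4 READ ON THE TYPER'S OBJECT: `TOfLeg_tableRedF_eq_dressedEntryP`, `bondSecondMoment_TOfLeg_tableRedF_eq_avgM2`,
  `secondMoment_TOfLeg_tableRedF_eq`, `bondSecondMoment_TOfLeg_tableRedF_eq_avgM2_of_inversion` — hypotheses VERBATIM those of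
  `ReducedKernelSandwich` / `MomentTransferParity` (the Ward rows `hrow`, the parity `hT1` / inversion `hinv` STAY hypotheses).
* §4 [folklore] THE TYPER'S SOCKETS READ ON A4'S OBJECT: `vertexFamily₂_tableRed`, `vertexFamily₂_tableRed'`, `tableRed_translate`.
NOT HERE: which fine tables are Bałaban's (T5/T6/CHECK-N0), any estimate uniform in `n`, anything of D1 / BetaPertH.  Unit
`b2b-balaban-beta-d1-formalise-leaf-01` (gen 2).
-/

noncomputable section

namespace Summit.QuantumFields.BalabanUV.Beta.D1BFx.ReducedTableBridge

open Finset
open scoped BigOperators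
open Literature.MathematicalPhysics.QuantumFieldTheory.Balaban1983to89
open Literature.MathematicalPhysics.QuantumFieldTheory.Balaban1983to89.Beta
open B12Sec2to5 (l1 l1_nonneg Decay510)
open ExpKernelCalculus (Site MKer Decays BiLoc VertexFamily₂ shiftK Zl Zl_nonneg)
open DecimatedMomentSummable (AbsMoment₂)
open DressedMomentNormalisation (EKer resSite)
open KernelSpecInstance (wH)
open MinimiserIdentityForm (wK)
open OneStepResolventKernel (wsum)
open Summit.QuantumFields.BalabanUV.Beta.TameKernelCalculus
open Summit.QuantumFields.BalabanUV.Beta.D1BFx.GluonLeg (Ga)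
open Summit.QuantumFields.BalabanUV.Beta.D1BFx.ReducedKernel (StencilR TableR vertexRed TOfRed)
open Summit.QuantumFields.BalabanUV.Beta.D1BFx.ReducedKernelF (TOfLeg TOfRed_eq_TOfLeg)
open Summit.QuantumFields.BalabanUV.Beta.D1BFx.ReducedTableF (tableRedF tableRedF_apply vertexFamily₂_tableRedF vertexFamily₂_tableRedF'
  tableRedF_translate)
open Summit.QuantumFields.BalabanUV.Beta.D1BFx.DressedBubbleBridge (summable_abs_of_expWeight expWeight_of_le)
open Summit.QuantumFields.BalabanUV.Beta.D1BFx.DressedBubbleTable (exists_expWeight_wH)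
open Summit.QuantumFields.BalabanUV.Beta.D1BFx.DressedTadpoleTable (Table₂R tableRed biLoc_wsum_snd)
open Summit.QuantumFields.BalabanUV.Beta.D1BFx.ReducedKernelSandwich (fineHess TOfRed_tableRed_eq_dressedEntryP
  bondSecondMoment_TOfRed_eq_avgM2 secondMoment_TOfRed_eq)
open Summit.QuantumFields.BalabanUV.Beta.D1BFx.MomentTransferPeriodic (baseKer)
open Summit.QuantumFields.BalabanUV.Beta.D1BFx.MomentTransferPeriodicEntry (dressedEntryP avgM2)
open Summit.QuantumFields.BalabanUV.Beta.D1BFx.MomentTransferParity (bondSecondMoment_TOfRed_eq_avgM2_of_inversion)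

/-! ## §1 Generic: a finite sum of superpositions with a common weight -/

section Generic

variable {D : ℕ} {F : Type*} {ι : Type*}

/-- [folklore] An absolutely summable weight times a bounded sequence is summable. -/
theorem summable_wmul_of_bound {w t : Site D → ℝ} (hw : Summable fun u => |w u|) {B : ℝ} (hB : ∀ u, |t u| ≤ B) :
    Summable fun u => w u * t u :=
  Summable.of_norm_bounded (hw.mul_right B) (fun u => by
    rw [Real.norm_eq_abs, abs_mul]; exact mul_le_mul_of_nonneg_left (hB u) (abs_nonneg _))

/-- [folklore] **A FINITE SUM OF SUPERPOSITIONS WITH A COMMON WEIGHT IS THE SUPERPOSITION OF THE FINITE SUM**, entrywise, given termwise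
summability: `Σ_{i∈s} Σ′_u w_u·K_i u = Σ′_u w_u·(Σ_{i∈s} K_i u)` (`Summable.tsum_finsetSum` + `Finset.mul_sum`). -/
theorem finset_sum_wsum (s : Finset ι) (w : Site D → ℝ) (K : ι → Site D → MKer D F) (x z : Site D) (a b : F)
    (hs : ∀ i ∈ s, Summable fun u => w u * K i u x z a b) :
    ∑ i ∈ s, wsum w (K i) x z a b = wsum w (fun u => fun x z a b => ∑ i ∈ s, K i u x z a b) x z a b := by
  simp only [wsum]
  rw [← Summable.tsum_finsetSum hs]
  exact tsum_congr fun u => by rw [Finset.mul_sum]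

end Generic

/-! ## §2 The bridge -/

variable (n : ℕ) [NeZero n]

/-- [our object, unfolding] `tableRed` entrywise (definitional). -/
theorem tableRed_apply (Wf : Table₂R) (μ : Fin 4) (y : Site 4) (ν : Fin 4) (y' : Site 4) (x z : Site 4) (a b : Fin 4) :
    tableRed n Wf μ y ν y' x z a b = ∑ κ' : Fin 4, wsum (fun u => wH (N := n) (d := 3) κ' μ (u - (n : ℤ) • y))
      (fun u => fun x z a b => ∑ l' : Fin 4, wsum (fun u' => wH (N := n) (d := 3) l' ν (u' - (n : ℤ) • y')) (Wf κ' u l') x z a b)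
      x z a b := rfl

variable {Wf : Table₂R} {C2 δ : ℝ}

/-- [folklore] The inner superposition `Σ′_{u′} ℋ_{(λ′,u′),(ν,y′)} · Wf κ′ u λ′ u′` is bounded UNIFORMLY in `u` and in the entry, for a fine
table family bi-localised at its two bonds (from `DressedTadpoleTable.biLoc_wsum_snd`). -/
theorem exists_bound_inner (hW : ∀ κ' u l' u', BiLoc (Wf κ' u l' u') u u' C2 δ) (hδ : 0 < δ) (ν : Fin 4) (y' : Site 4) :
    ∃ B : ℝ, ∀ (κ' l' : Fin 4) (u x z : Site 4) (a b : Fin 4),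
      |wsum (fun u' => wH (N := n) (d := 3) l' ν (u' - (n : ℤ) • y')) (Wf κ' u l') x z a b| ≤ B := by
  obtain ⟨Cw, δw, hCw, hδw, hw⟩ := exists_expWeight_wH n
  have hm : 0 < min δw δ := lt_min hδw hδ
  refine ⟨Cw * |C2| * Zl 4 (min δw δ / 2), fun κ' l' u x z a b => ?_⟩
  have hin : BiLoc (wsum (fun u' => wH (N := n) (d := 3) l' ν (u' - (n : ℤ) • y')) (Wf κ' u l')) u ((n : ℤ) • y')
      (Cw * |C2| * Zl 4 (min δw δ / 2)) (min δw δ / 2) :=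
    biLoc_wsum_snd (fun u' => expWeight_of_le (hw l' ν y') hCw (min_le_left _ _) u')
      (fun u' => biLoc_of_le (hW κ' u l' u') (min_le_right _ _)) hm hCw
  refine (hin x z a b).trans ?_
  have hB : 0 ≤ Cw * |C2| * Zl 4 (min δw δ / 2) := mul_nonneg (mul_nonneg hCw (abs_nonneg _)) (Zl_nonneg (by linarith))
  refine mul_le_of_le_one_right hB (Real.exp_le_one_iff.2 ?_)
  nlinarith [l1_nonneg (x - u), l1_nonneg (z - (n : ℤ) • y'), hm.le]

/-- [folklore] **THE BRIDGE `tableRedF = tableRed` AT THE FIBRE `Fin 4`.**  For a second-order fine table family bi-localised at its two bonds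
(`BiLoc (Wf κ′ u λ′ u′) u u′ C δ`, `0 < δ` — the road's standing hypothesis, under which both sides converge absolutely), the typer's
`ReducedTableF.tableRedF n Wf` (finite sum `Σ_{λ′}` OUTSIDE the outer series) equals leaf A4's `DressedTadpoleTable.tableRed n Wf` (the
ITERATED chain-rule vertex, `Σ_{λ′}` INSIDE): one exchange `Σ_{λ′} Σ′_u = Σ′_u Σ_{λ′}` per `κ′`, licensed by the absolute summability of the
`ℋ`-weights times the uniform bound of the inner superpositions.  Not `rfl`; an unconditional version is not claimed. -/
theorem tableRedF_eq_tableRed (hW : ∀ κ' u l' u', BiLoc (Wf κ' u l' u') u u' C2 δ) (hδ : 0 < δ) :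
    tableRedF n Wf = tableRed n Wf := by
  obtain ⟨Cw, δw, hCw, hδw, hw⟩ := exists_expWeight_wH n
  funext μ y ν y' x z a b
  obtain ⟨B, hB⟩ := exists_bound_inner n hW hδ ν y'
  rw [tableRedF_apply, tableRed_apply]
  refine Finset.sum_congr rfl fun κ' _ => ?_
  exact finset_sum_wsum (Finset.univ : Finset (Fin 4)) (fun u => wH (N := n) (d := 3) κ' μ (u - (n : ℤ) • y))
    (fun l' u => wsum (fun u' => wH (N := n) (d := 3) l' ν (u' - (n : ℤ) • y')) (Wf κ' u l')) x z a b
    (fun l' _ => summable_wmul_of_bound (summable_abs_of_expWeight (hw κ' μ y) hδw) (fun u => hB κ' l' u x z a b))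

/-- [folklore] Hence the reduced one-shot kernels built on the two tables coincide: `TOfLeg n (Ga n a) S (tableRedF n Wf) = TOfRed n a S
(tableRed n Wf)` (`ReducedKernelF.TOfRed_eq_TOfLeg` is `rfl`; the table slot by the bridge). -/
theorem TOfLeg_tableRedF_eq_TOfRed_tableRed (a : ℝ) (S : StencilR) (hW : ∀ κ' u l' u', BiLoc (Wf κ' u l' u') u u' C2 δ)
    (hδ : 0 < δ) : TOfLeg n (Ga n a) S (tableRedF n Wf) = TOfRed n a S (tableRed n Wf) := by
  rw [tableRedF_eq_tableRed n hW hδ, TOfRed_eq_TOfLeg]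

/-! ## §3 Leaf A4 read on the typer's object -/

variable (a : ℝ) {S : StencilR} {Cs : ℝ}

/-- [folklore] **A4's SANDWICH IDENTITY ON `tableRedF`**: `TOfLeg n (Ga n a) S (tableRedF n Wf) μ ν z = dressedEntryP (wK n) (fineHess n a S Wf)
(n•(−z)) μ ν` — `ReducedKernelSandwich.TOfRed_tableRed_eq_dressedEntryP` through the bridge; hypotheses verbatim. -/
theorem TOfLeg_tableRedF_eq_dressedEntryP (hn : 1 ≤ n) (hGa : Spr (Ga n a)) (hS : ∀ κ' u, BiLoc (S κ' u) u u Cs δ)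
    (hW : ∀ κ' u l' u', BiLoc (Wf κ' u l' u') u u' C2 δ) (hδ : 0 < δ)
    (hScov : ∀ (κ' : Fin 4) (u v : Site 4), S κ' (u + v) = shiftK (-v) (S κ' u))
    (hWcov : ∀ (κ' : Fin 4) (u : Site 4) (l' : Fin 4) (u' v : Site 4), Wf κ' (u + v) l' (u' + v) = shiftK (-v) (Wf κ' u l' u'))
    (μ ν : Fin 4) (z : Site 4) :
    TOfLeg n (Ga n a) S (tableRedF n Wf) μ ν z = dressedEntryP (wK n) (fineHess n a S Wf) ((n : ℤ) • (-z)) μ ν := by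
  rw [TOfLeg_tableRedF_eq_TOfRed_tableRed n a S hW hδ]
  exact TOfRed_tableRed_eq_dressedEntryP n a hn hGa hS hW hδ hScov hWcov μ ν z

/-- [folklore] **A4's END ON `tableRedF`** (`ReducedKernelSandwich.bondSecondMoment_TOfRed_eq_avgM2` through the bridge): the coarse bond
second moment `Σ′_z z_κ z_λ · n⁸ · TOfLeg n (Ga n a) S (tableRedF n Wf) μ ν z = avgM2 n (fineHess n a S Wf μ ν) κ λ`, GIVEN — hypotheses,
not proved here — the per-entry Ward row sums `hrow` and the base-point-summed first moments `hT1` of `fineHess`. -/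
theorem bondSecondMoment_TOfLeg_tableRedF_eq_avgM2 (hn : 1 ≤ n) (hGa : Spr (Ga n a)) (hS : ∀ κ' u, BiLoc (S κ' u) u u Cs δ)
    (hW : ∀ κ' u l' u', BiLoc (Wf κ' u l' u') u u' C2 δ) (hδ : 0 < δ)
    (hScov : ∀ (κ' : Fin 4) (u v : Site 4), S κ' (u + v) = shiftK (-v) (S κ' u))
    (hWcov : ∀ (κ' : Fin 4) (u : Site 4) (l' : Fin 4) (u' v : Site 4), Wf κ' (u + v) l' (u' + v) = shiftK (-v) (Wf κ' u l' u'))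
    (hWsymm : ∀ (κ' : Fin 4) (u : Site 4) (l' : Fin 4) (u' : Site 4), Wf κ' u l' u' = Wf l' u' κ' u)
    (hrow : ∀ (κ' l' : Fin 4) (b : Site 4), HasSum (fineHess n a S Wf κ' l' b) 0)
    (hT1 : ∀ (κ' l' μ' : Fin 4), ∑ r : Fin 4 → Fin n, ∑' t, (t μ' : ℝ) * baseKer (fineHess n a S Wf κ' l') (resSite r) t = 0)
    (κ lam μ ν : Fin 4) :
    ∑' z : Site 4, ((z κ * z lam : ℤ) : ℝ) * ((n : ℝ) ^ 8 * TOfLeg n (Ga n a) S (tableRedF n Wf) μ ν z)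
      = avgM2 n (fineHess n a S Wf μ ν) κ lam := by
  rw [TOfLeg_tableRedF_eq_TOfRed_tableRed n a S hW hδ]
  exact bondSecondMoment_TOfRed_eq_avgM2 n a hn hGa hS hW hδ hScov hWcov hWsymm hrow hT1 κ lam μ ν

/-- [folklore] The same in `B12Beta.secondMoment` currency (`ReducedKernelSandwich.secondMoment_TOfRed_eq` through the bridge):
`Σ′_z TOfLeg n (Ga n a) S (tableRedF n Wf) μ ν z · z_κ · z_λ = n⁻⁸ · avgM2 n (fineHess μ ν) κ λ`. -/
theorem secondMoment_TOfLeg_tableRedF_eq (hn : 1 ≤ n) (hGa : Spr (Ga n a)) (hS : ∀ κ' u, BiLoc (S κ' u) u u Cs δ)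
    (hW : ∀ κ' u l' u', BiLoc (Wf κ' u l' u') u u' C2 δ) (hδ : 0 < δ)
    (hScov : ∀ (κ' : Fin 4) (u v : Site 4), S κ' (u + v) = shiftK (-v) (S κ' u))
    (hWcov : ∀ (κ' : Fin 4) (u : Site 4) (l' : Fin 4) (u' v : Site 4), Wf κ' (u + v) l' (u' + v) = shiftK (-v) (Wf κ' u l' u'))
    (hWsymm : ∀ (κ' : Fin 4) (u : Site 4) (l' : Fin 4) (u' : Site 4), Wf κ' u l' u' = Wf l' u' κ' u)
    (hrow : ∀ (κ' l' : Fin 4) (b : Site 4), HasSum (fineHess n a S Wf κ' l' b) 0)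
    (hT1 : ∀ (κ' l' μ' : Fin 4), ∑ r : Fin 4 → Fin n, ∑' t, (t μ' : ℝ) * baseKer (fineHess n a S Wf κ' l') (resSite r) t = 0)
    (κ lam μ ν : Fin 4) :
    ∑' z : Site 4, TOfLeg n (Ga n a) S (tableRedF n Wf) μ ν z * (z κ : ℝ) * (z lam : ℝ)
      = ((n : ℝ) ^ 8)⁻¹ * avgM2 n (fineHess n a S Wf μ ν) κ lam := by
  rw [TOfLeg_tableRedF_eq_TOfRed_tableRed n a S hW hδ]
  exact secondMoment_TOfRed_eq n a hn hGa hS hW hδ hScov hWcov hWsymm hrow hT1 κ lam μ ν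

/-- [folklore] **A4's END ON `tableRedF`, PARITY DISCHARGED BY INVERSION** (`MomentTransferParity.bondSecondMoment_TOfRed_eq_avgM2_of_inversion`
through the bridge): Ward rows `hrow` + an affine inversion covariance `hinv` of `fineHess` instead of the first-moment hypothesis. -/
theorem bondSecondMoment_TOfLeg_tableRedF_eq_avgM2_of_inversion (hn : 1 ≤ n) (hGa : Spr (Ga n a))
    (hS : ∀ κ' u, BiLoc (S κ' u) u u Cs δ) (hW : ∀ κ' u l' u', BiLoc (Wf κ' u l' u') u u' C2 δ) (hδ : 0 < δ)
    (hScov : ∀ (κ' : Fin 4) (u v : Site 4), S κ' (u + v) = shiftK (-v) (S κ' u))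
    (hWcov : ∀ (κ' : Fin 4) (u : Site 4) (l' : Fin 4) (u' v : Site 4), Wf κ' (u + v) l' (u' + v) = shiftK (-v) (Wf κ' u l' u'))
    (hWsymm : ∀ (κ' : Fin 4) (u : Site 4) (l' : Fin 4) (u' : Site 4), Wf κ' u l' u' = Wf l' u' κ' u)
    (hrow : ∀ (κ' l' : Fin 4) (b : Site 4), HasSum (fineHess n a S Wf κ' l' b) 0)
    {a₁ a₂ : Fin 4 → Site 4}
    (hinv : ∀ (κ' l' : Fin 4) (s s' : Site 4), fineHess n a S Wf κ' l' (a₁ κ' - s) (a₂ l' - s') = fineHess n a S Wf κ' l' s s')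
    (κ lam μ ν : Fin 4) :
    ∑' z : Site 4, ((z κ * z lam : ℤ) : ℝ) * ((n : ℝ) ^ 8 * TOfLeg n (Ga n a) S (tableRedF n Wf) μ ν z)
      = avgM2 n (fineHess n a S Wf μ ν) κ lam := by
  rw [TOfLeg_tableRedF_eq_TOfRed_tableRed n a S hW hδ]
  exact bondSecondMoment_TOfRed_eq_avgM2_of_inversion n a hn hGa hS hW hδ hScov hWcov hWsymm hrow hinv κ lam μ ν

/-! ## §4 The typer's sockets read on leaf A4's object -/

/-- [folklore] **`tableRed` IS A SECOND-ORDER VERTEX FAMILY** (explicit constant; `ReducedTableF.vertexFamily₂_tableRedF` through the bridge):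
fine tables bi-localised at `(u, u′)` with constant `Cf`, rate `δ`, weights `Decay510 (wH κ l) Cw δw` with `δ ≤ δw` ⇒
`VertexFamily₂ (tableRed n Wf) n (4·(4·(Cw·(Cw·Cf·Zl(δ/2))·Zl(δ/4)))) (δ/4)`. -/
theorem vertexFamily₂_tableRed {Cf : ℝ} (hWf : ∀ κ' u l' u', BiLoc (Wf κ' u l' u') u u' Cf δ) (hδ : 0 < δ) {Cw δw : ℝ}
    (hCw : 0 ≤ Cw) (hδw : δ ≤ δw) (hwH : ∀ κ l : Fin 4, Decay510 (wH (N := n) (d := 3) κ l) Cw δw) :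
    VertexFamily₂ (tableRed n Wf) n ((4 : ℕ) * ((4 : ℕ) * (Cw * (Cw * Cf * Zl 4 (δ / 2)) * Zl 4 (δ / 2 / 2)))) (δ / 2 / 2) := by
  rw [← tableRedF_eq_tableRed n hWf hδ]
  exact vertexFamily₂_tableRedF n hWf hδ hCw hδw hwH

/-- [folklore] The packaged `∃`-form (`ReducedTableF.vertexFamily₂_tableRedF'` through the bridge) — the `hW : VertexFamily₂ W n Cw δ2` input of
`ReducedKernel.absMoment₂_TOfRed` / `ReducedKernelF.absMoment₂_TOfLeg` for `W := tableRed n Wf`. -/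
theorem vertexFamily₂_tableRed' {Cf : ℝ} (hWf : ∀ κ' u l' u', BiLoc (Wf κ' u l' u') u u' Cf δ) (hδ : 0 < δ) :
    ∃ Cw2 δ2 : ℝ, 0 < δ2 ∧ δ2 ≤ δ ∧ VertexFamily₂ (tableRed n Wf) n Cw2 δ2 := by
  rw [← tableRedF_eq_tableRed n hWf hδ]
  exact vertexFamily₂_tableRedF' n hWf hδ

/-- [folklore] **BLOCK COVARIANCE OF `tableRed`** (`ReducedTableF.tableRedF_translate` through the bridge): block covariance of the fine tables
`Wf κ′ (u + n•t) λ′ (u′ + n•t) = shiftK (−n•t) (Wf κ′ u λ′ u′)` ⇒ `tableRed n Wf μ (y + t) ν (y′ + t) = shiftK (−n•t) (tableRed n Wf μ y ν y′)` —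
the `hW` of `ReducedKernel.blockCovariant_TOfRed` / `ReducedKernelF.blockCovariant_TOfLeg`. -/
theorem tableRed_translate {Cf : ℝ} (hWf : ∀ κ' u l' u', BiLoc (Wf κ' u l' u') u u' Cf δ) (hδ : 0 < δ)
    (hWcov : ∀ (κ' : Fin 4) (u : Site 4) (l' : Fin 4) (u' t : Site 4),
      Wf κ' (u + (n : ℤ) • t) l' (u' + (n : ℤ) • t) = shiftK (-((n : ℤ) • t)) (Wf κ' u l' u'))
    (μ : Fin 4) (y : Site 4) (ν : Fin 4) (y' t : Site 4) :
    tableRed n Wf μ (y + t) ν (y' + t) = shiftK (-((n : ℤ) • t)) (tableRed n Wf μ y ν y') := by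
  rw [← tableRedF_eq_tableRed n hWf hδ]
  exact tableRedF_translate n hWcov μ y ν y' t

/-- [folklore] The same from FINE translation covariance (all fine vectors `v`, the form A4's hypotheses `hWcov` take), specialised to block
vectors. -/
theorem tableRed_translate_of_fine {Cf : ℝ} (hWf : ∀ κ' u l' u', BiLoc (Wf κ' u l' u') u u' Cf δ) (hδ : 0 < δ)
    (hWcov : ∀ (κ' : Fin 4) (u : Site 4) (l' : Fin 4) (u' v : Site 4), Wf κ' (u + v) l' (u' + v) = shiftK (-v) (Wf κ' u l' u'))
    (μ : Fin 4) (y : Site 4) (ν : Fin 4) (y' t : Site 4) :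
    tableRed n Wf μ (y + t) ν (y' + t) = shiftK (-((n : ℤ) • t)) (tableRed n Wf μ y ν y') :=
  tableRed_translate n hWf hδ (fun κ' u l' u' t => hWcov κ' u l' u' ((n : ℤ) • t)) μ y ν y' t

end Summit.QuantumFields.BalabanUV.Beta.D1BFx.ReducedTableBridge

end
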